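import Summits.CriticalPhenomena.SAWScalingLimit.Theses.SAWReversalUpgrade
import Summits.CriticalPhenomena.SAWScalingLimit.Theorems.SAWReversalUpgradeFaithfulOfNoReturnEstimate
import Summits.CriticalPhenomena.SAWScalingLimit.Theorems.SAWReversalUpgradeFaithfulOfNoReturnPolyline
import Literature.Barriers.CriticalPhenomena.SupercriticalSAWSpaceFillingReversible
import HarnessLib

/-!
# Route `SAWReversalUpgrade`: proof of the support item `FaithfulOfNoReturn`
# (stmt-CriticalPhenomena-18008)

`FaithfulOfNoReturn_proof : Theses.SAWReversalUpgrade.FaithfulOfNoReturn` — under no deep return to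
`a` (for `(D; a, b)`) and to `b` (for `(D.swap; b, a)`), every eventually-standard boundary
attachment `att` of the critical SAW is faithful: for every `ε > 0`,
`P_δ (dist (⟦att γ⟧, γ.curve) ≥ ε) → 0` as `δ → 0⁺`.

Proof. Fix `ε, η > 0`; put `ε₀ = min (ε/2) (|a-b|/2)`, take `rₐ` from no-deep-return at `a`
(level `ε₀`, mass `η/3`) and `r_b` from no-deep-return at `b` in `D.swap` (level `ε₀/2`, mass `η/3`),
`r₀ = min rₐ (r_b/2) (ε₀/2)`. For small `δ`: the squeeze `A_{min δ 1/2}` is `r₀/4`-close to the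
identity through `Φ` (`exists_squeeze_close`), the access segment and exit ray lie in
`B(a, r₀/4)`, `B(b, r₀/4)` (Carathéodory continuity at `0`/`a` and `∞`/`b` + endpoint approximation).
On the complement of the two deep-return events the deterministic estimate
`reparamDist_le_of_standard` (helper file 9; the SAW polyline is flat, helper file 10) gives
`dist (⟦att γ⟧, γ.curve) ≤ ε₀ + r₀/4 < ε`; the escape-from-`b` event of the polyline is a
deep-return event of the REVERSED polyline (`escape_transfer`, `curve_sawReverse`), whose law is the
`D.swap` SAW law (`lawAt_map_sawReverse`). Hence the bad event has mass `≤ 2η/3 < η` eventually.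
The route's attachment `let`-block is, definitionally, membership in
`AttachReversal.standardCurves` (`faithfulOfNoReturn_iff`, by `Iff.rfl`).
-/

noncomputable section

open Set Filter Metric Function MeasureTheory
open scoped Topology unitInterval ENNReal
open UpperHalfPlane (upperHalfPlaneSet)
open Literature.Probability.RandomPlanarGeometry Literature.Probability.LatticeModels
open Literature.Barriers.CriticalPhenomena.SupercriticalSAW (sawReverse lawAt_map_sawReverse curve_sawReverse
  lawAt_criticalFugacity)

namespace Summit.CriticalPhenomena.SAWScalingLimit.Theorems

namespace FaithfulAttach

open AttachReversal

/-! ### Transfer of the escape event to the reversed curve -/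

/-- **An escape from `b` of `P` is a deep return to `b` of any curve `Q` in the reversed class of
`P`**, with levels perturbed by an arbitrary `η > 0`. -/
theorem escape_transfer {P Q : Curve ℂ} (hPQ : CurveClass.mk Q = (CurveClass.mk P).reverse) {b : ℂ}
    {ε₀ r₀ η : ℝ} (hη : 0 < η) {s t : I} (hts : t < s) (ht : dist (P t) b ≤ r₀) (hs : ε₀ ≤ dist (P s) b) :
    ∃ s' t' : I, s' < t' ∧ ε₀ - η ≤ dist (Q s') b ∧ dist (Q t') b ≤ r₀ + η := by
  rw [CurveClass.reverse_mk, CurveClass.mk_eq_mk_iff_dist_eq_zero] at hPQ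
  obtain ⟨φ, hφ⟩ := Curve.exists_dist_reparam_lt (show dist Q P.reverse < η by rw [hPQ]; exact hη)
  have hpt : ∀ u : I, dist (Q u) (P (σ (φ u))) < η := fun u =>
    lt_of_le_of_lt (ContinuousMap.dist_apply_le_dist (f := Q.toContinuousMap)
      (g := ((P.reverse).reparam φ).toContinuousMap) u) hφ
  refine ⟨φ.symm (σ s), φ.symm (σ t), ?_, ?_, ?_⟩
  · rw [OrderIso.lt_iff_lt]
    show ((σ s : I) : ℝ) < (σ t : I)
    rw [unitInterval.coe_symm_eq, unitInterval.coe_symm_eq]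
    exact sub_lt_sub_left (show (t : ℝ) < s from hts) 1
  · have h := hpt (φ.symm (σ s))
    rw [OrderIso.apply_symm_apply, unitInterval.symm_symm] at h
    linarith [dist_triangle_left (P s) b (Q (φ.symm (σ s)))]
  · have h := hpt (φ.symm (σ t))
    rw [OrderIso.apply_symm_apply, unitInterval.symm_symm] at h
    linarith [dist_triangle (Q (φ.symm (σ t))) (P t) b]

/-! ### Small facts about the polyline and `projLine` -/

/-- On `[0, 1]`, `projLine P s = P ⟨s, _⟩`. -/
theorem projLine_of_mem (P : C(I, ℂ)) {s : ℝ} (hs : s ∈ Icc (0:ℝ) 1) : projLine P s = P ⟨s, hs⟩ := by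
  simp only [projLine, projIcc_of_mem _ hs]

/-! ### The faithfulness theorem in `standardCurves` form -/

/-- **Faithfulness of standard attachments** (the route item with its attachment `let`-block read as
membership in `AttachReversal.standardCurves`). -/
theorem faithful_standard (D : DobrushinDomain) (a b : ℝ → Site 2) (happ : SAW.IsEndpointApprox D a b)
    (φ : ConformalEquiv upperHalfPlaneSet D.carrier) (hφ : D.IsChordalUniformizing φ)
    (att : (δ : ℝ) → SAW.DomainSAW D.carrier δ (a δ) (b δ) → Curve ℂ)
    (hatt : ∀ᶠ δ in 𝓝[>] (0:ℝ), ∀ γ : SAW.DomainSAW D.carrier δ (a δ) (b δ),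
      att δ γ ∈ standardCurves (D.pt 0) (D.pt 1) φ.boundaryExtension (min δ (1/2))
        (projLine (γ.walk.toCurve (meshPoint δ))) D.carrier)
    (hNa : ∀ ε : ℝ, 0 < ε → ∀ η : ℝ, 0 < η → ∃ r : ℝ, 0 < r ∧ ∀ᶠ δ in 𝓝[>] (0:ℝ),
      SAW.law D.carrier δ (a δ) (b δ) {γ | ∃ s t : I, s < t ∧
        ε ≤ dist (γ.walk.toCurve (meshPoint δ) s) (D.pt 0) ∧
        dist (γ.walk.toCurve (meshPoint δ) t) (D.pt 0) ≤ r} ≤ ENNReal.ofReal η)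
    (hNb : ∀ ε : ℝ, 0 < ε → ∀ η : ℝ, 0 < η → ∃ r : ℝ, 0 < r ∧ ∀ᶠ δ in 𝓝[>] (0:ℝ),
      SAW.law D.swap.carrier δ (b δ) (a δ) {γ | ∃ s t : I, s < t ∧
        ε ≤ dist (γ.walk.toCurve (meshPoint δ) s) (D.swap.pt 0) ∧
        dist (γ.walk.toCurve (meshPoint δ) t) (D.swap.pt 0) ≤ r} ≤ ENNReal.ofReal η)
    (ε : ℝ) (hε : 0 < ε) :
    Tendsto (fun δ : ℝ => (SAW.law D.carrier δ (a δ) (b δ)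
      {γ | ε ≤ dist (CurveClass.mk (att δ γ)) γ.curve}).toReal) (𝓝[>] (0:ℝ)) (𝓝 0) := by
  rw [Metric.tendsto_nhds]
  intro η hη
  -- constants
  have hab' : D.pt 0 ≠ D.pt 1 := D.pt_injective.ne (by decide)
  have hdab : 0 < dist (D.pt 0) (D.pt 1) := dist_pos.2 hab'
  set ε₀ : ℝ := min (ε / 2) (dist (D.pt 0) (D.pt 1) / 2) with hε₀
  have hε₀0 : 0 < ε₀ := lt_min (half_pos hε) (half_pos hdab)
  have h2ε₀ : 2 * ε₀ ≤ dist (D.pt 0) (D.pt 1) := by linarith [min_le_right (ε / 2) (dist (D.pt 0) (D.pt 1) / 2)]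
  have hε₀ε : ε₀ ≤ ε / 2 := min_le_left _ _
  obtain ⟨ra, hra, hA⟩ := hNa ε₀ hε₀0 (η / 3) (by positivity)
  obtain ⟨rb, hrb, hB⟩ := hNb (ε₀ / 2) (half_pos hε₀0) (η / 3) (by positivity)
  set r₀ : ℝ := min (min ra (rb / 2)) (ε₀ / 2) with hr₀def
  have hr₀ : 0 < r₀ := lt_min (lt_min hra (half_pos hrb)) (half_pos hε₀0)
  have hr₀a : r₀ ≤ ra := (min_le_left _ _).trans (min_le_left _ _)
  have hr₀b : 2 * r₀ ≤ rb := by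
    have : r₀ ≤ rb / 2 := (min_le_left _ _).trans (min_le_right _ _)
    linarith
  have hr₀ε : r₀ ≤ ε₀ / 2 := min_le_right _ _
  have hrε : r₀ < ε₀ := by linarith
  have hκ : 0 < r₀ / 4 := by positivity
  obtain ⟨e₀, he₀, -, hclose⟩ := exists_squeeze_close hφ hκ
  obtain ⟨ρ', hρ', hacc0⟩ := exists_norm_lt_dist_bext_lt hφ hκ
  obtain ⟨ρa, hρa, hψa⟩ := exists_dist_lt_norm_hinv_lt hφ hρ'
  obtain ⟨M, -, hfar⟩ := exists_norm_le_dist_bext_lt hφ hκ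
  obtain ⟨ρb, hρb, hψb⟩ := exists_dist_lt_lt_norm_hinv hφ M
  -- eventual smallness of `δ` and of the endpoint errors
  have ev1 : ∀ᶠ δ in 𝓝[>] (0:ℝ), (0:ℝ) < δ := self_mem_nhdsWithin
  have ev2 : ∀ᶠ δ in 𝓝[>] (0:ℝ), δ < e₀ := Filter.eventually_of_mem (Ioo_mem_nhdsGT he₀) fun δ hδ => hδ.2
  have ev3 : ∀ᶠ δ in 𝓝[>] (0:ℝ), dist (meshPoint δ (a δ)) (D.pt 0) < min ρa (min (r₀ / 4) ε₀) :=
    Metric.tendsto_nhds.1 happ.tendsto_fst _ (lt_min hρa (lt_min hκ hε₀0))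
  have ev4 : ∀ᶠ δ in 𝓝[>] (0:ℝ), dist (meshPoint δ (b δ)) (D.pt 1) < min ρb (min (r₀ / 4) ε₀) :=
    Metric.tendsto_nhds.1 happ.tendsto_snd _ (lt_min hρb (lt_min hκ hε₀0))
  filter_upwards [hatt, hA, hB, ev1, ev2, ev3, ev4] with δ hstd hAδ hBδ hδ hδe hda hdb
  rw [Real.dist_0_eq_abs, abs_of_nonneg ENNReal.toReal_nonneg]
  have hda' : dist (meshPoint δ (a δ)) (D.pt 0) < ρa := hda.trans_le (min_le_left _ _)
  have hda'' : dist (meshPoint δ (a δ)) (D.pt 0) < r₀ / 4 :=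
    hda.trans_le ((min_le_right _ _).trans (min_le_left _ _))
  have hdb' : dist (meshPoint δ (b δ)) (D.pt 1) < ρb := hdb.trans_le (min_le_left _ _)
  have hdb'' : dist (meshPoint δ (b δ)) (D.pt 1) < r₀ / 4 :=
    hdb.trans_le ((min_le_right _ _).trans (min_le_left _ _))
  -- the lattice endpoints differ
  have hne : a δ ≠ b δ := by
    intro h
    have h1 : dist (meshPoint δ (a δ)) (D.pt 0) < ε₀ := hda.trans_le ((min_le_right _ _).trans (min_le_right _ _))
    have h2 : dist (meshPoint δ (b δ)) (D.pt 1) < ε₀ := hdb.trans_le ((min_le_right _ _).trans (min_le_right _ _))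
    rw [h] at h1
    exact not_close_both h2ε₀ h1 h2
  -- the squeeze parameter
  have he0' : 0 < min δ (1 / 2) := lt_min hδ (by norm_num)
  have he1' : min δ (1 / 2) ≤ 1 / 2 := min_le_right _ _
  have hclose' := hclose (min δ (1 / 2)) he0' ((min_le_left _ _).trans hδe.le)
  -- the bad event is covered by the two deep-return events
  set badA : Set (SAW.DomainSAW D.carrier δ (a δ) (b δ)) := {γ | ∃ s t : I, s < t ∧
      ε₀ ≤ dist (γ.walk.toCurve (meshPoint δ) s) (D.pt 0) ∧
      dist (γ.walk.toCurve (meshPoint δ) t) (D.pt 0) ≤ ra} with hbadA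
  set badB : Set (SAW.DomainSAW D.swap.carrier δ (b δ) (a δ)) := {γ | ∃ s t : I, s < t ∧
      ε₀ / 2 ≤ dist (γ.walk.toCurve (meshPoint δ) s) (D.swap.pt 0) ∧
      dist (γ.walk.toCurve (meshPoint δ) t) (D.swap.pt 0) ≤ rb} with hbadB
  have hsub : {γ : SAW.DomainSAW D.carrier δ (a δ) (b δ) | ε ≤ dist (CurveClass.mk (att δ γ)) γ.curve} ⊆
      badA ∪ sawReverse ⁻¹' badB := by
    intro γ hγ
    by_contra hnot
    rw [mem_union, not_or, mem_preimage] at hnot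
    set P := γ.walk.toCurve (meshPoint δ) with hP
    have hP0 : P 0 = meshPoint δ (a δ) := SimpleGraph.Walk.toCurve_apply_zero _ _
    have hP1 : P 1 = meshPoint δ (b δ) := SimpleGraph.Walk.toCurve_apply_one _ _
    have hPmem : ∀ t : I, P t ∈ closure D.carrier := toCurve_mem_closure' γ hne
    have hP0D : P 0 ∈ D.carrier := hP0 ▸ meshPoint_fst_mem γ hne
    have hP1D : P 1 ∈ D.carrier := hP1 ▸ meshPoint_snd_mem γ hne
    have hflat : (⟨P⟩ : Curve ℂ).IsFlat := isFlat_toCurve γ hδ.ne'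
    have hR0 : dist (projLine P 0) (D.pt 0) < r₀ / 4 := by rw [projLine_zero, hP0]; exact hda''
    have hR1 : dist (projLine P 1) (D.pt 1) < r₀ / 4 := by rw [projLine_one, hP1]; exact hdb''
    have hacc : ∀ z : ℂ, 0 ≤ z.im → ‖z‖ ≤ ‖hinv φ.boundaryExtension (projLine P 0)‖ →
        dist (φ.boundaryExtension z) (D.pt 0) < r₀ / 4 := by
      intro z hz hzle
      refine hacc0 z hz (hzle.trans_lt ?_)
      rw [projLine_zero, hP0]
      exact hψa _ (subset_closure (hP0 ▸ hP0D)) hda'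
    have hex : ∀ z : ℂ, 0 ≤ z.im → ‖hinv φ.boundaryExtension (projLine P 1)‖ ≤ ‖z‖ →
        dist (φ.boundaryExtension z) (D.pt 1) < r₀ / 4 := by
      intro z hz hle
      refine hfar z hz (le_trans ?_ hle)
      rw [projLine_one, hP1]
      exact (hψb _ (subset_closure (hP1 ▸ hP1D))
        (fun h => MarkedDomain.pt_notMem_carrier D 1 (h ▸ hP1 ▸ hP1D)) hdb').le
    have hNR : ∀ s t : ℝ, 0 ≤ s → s < t → t ≤ 1 → ε₀ ≤ dist (projLine P s) (D.pt 0) →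
        dist (projLine P t) (D.pt 0) ≤ r₀ → False := by
      intro s t hs0 hst ht1 hεs hrt
      have hs : s ∈ Icc (0:ℝ) 1 := ⟨hs0, hst.le.trans ht1⟩
      have ht : t ∈ Icc (0:ℝ) 1 := ⟨hs0.trans hst.le, ht1⟩
      rw [projLine_of_mem P hs] at hεs
      rw [projLine_of_mem P ht] at hrt
      exact hnot.1 ⟨⟨s, hs⟩, ⟨t, ht⟩, hst, hεs, hrt.trans hr₀a⟩
    have hNE : ∀ s t : ℝ, 0 ≤ t → t < s → s ≤ 1 → dist (projLine P t) (D.pt 1) ≤ r₀ →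
        ε₀ ≤ dist (projLine P s) (D.pt 1) → False := by
      intro s t ht0 hts hs1 hrt hεs
      have hs : s ∈ Icc (0:ℝ) 1 := ⟨ht0.trans hts.le, hs1⟩
      have ht : t ∈ Icc (0:ℝ) 1 := ⟨ht0, hts.le.trans hs1⟩
      rw [projLine_of_mem P hs] at hεs
      rw [projLine_of_mem P ht] at hrt
      have hPQ : CurveClass.mk (⟨(sawReverse γ).walk.toCurve (meshPoint δ)⟩ : Curve ℂ) =
          (CurveClass.mk (⟨P⟩ : Curve ℂ)).reverse := curve_sawReverse γ
      obtain ⟨s', t', hlt, h1, h2⟩ := escape_transfer hPQ hr₀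
        (show (⟨t, ht⟩ : I) < ⟨s, hs⟩ from hts) hrt hεs
      have h1' : ε₀ - r₀ ≤ dist ((sawReverse γ).walk.toCurve (meshPoint δ) s') (D.pt 1) := h1
      have h2' : dist ((sawReverse γ).walk.toCurve (meshPoint δ) t') (D.pt 1) ≤ r₀ + r₀ := h2
      refine hnot.2 ⟨s', t', hlt, ?_, ?_⟩
      · rw [MarkedDomain.pt_swap_zero]
        change ε₀ / 2 ≤ dist ((sawReverse γ).walk.toCurve (meshPoint δ) s') (D.pt 1)
        linarith
      · rw [MarkedDomain.pt_swap_zero]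
        change dist ((sawReverse γ).walk.toCurve (meshPoint δ) t') (D.pt 1) ≤ rb
        linarith
    have hdist := reparamDist_le_of_standard hφ he0' he1' hPmem hP0D hP1D hflat hr₀ hrε h2ε₀ hκ le_rfl
      hclose' hacc hex hR0 hR1 hNR hNE (hstd γ)
    have hlt : dist (CurveClass.mk (att δ γ)) γ.curve < ε := by
      change dist (CurveClass.mk (att δ γ)) (CurveClass.mk (⟨P⟩ : Curve ℂ)) < ε
      rw [CurveClass.mk_eq_separationQuotientMk, SeparationQuotient.dist_mk]
      calc dist (att δ γ) ⟨P⟩ = Curve.reparamDist (att δ γ) ⟨P⟩ := rfl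
        _ ≤ ε₀ + r₀ / 4 := hdist
        _ < ε := by linarith
    exact (not_lt.2 hγ) hlt
  -- the reversed event has the `D.swap` law
  have hrev : SAW.law D.carrier δ (a δ) (b δ) (sawReverse ⁻¹' badB) = SAW.law D.swap.carrier δ (b δ) (a δ) badB := by
    rw [← Measure.map_apply (SAW.DomainSAW.measurable_of_top _) MeasurableSpace.measurableSet_top,
      ← lawAt_criticalFugacity, lawAt_map_sawReverse]
    rfl
  have hle : SAW.law D.carrier δ (a δ) (b δ)
      {γ | ε ≤ dist (CurveClass.mk (att δ γ)) γ.curve} ≤ ENNReal.ofReal (η / 3 + η / 3) := by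
    calc SAW.law D.carrier δ (a δ) (b δ) {γ | ε ≤ dist (CurveClass.mk (att δ γ)) γ.curve}
        ≤ SAW.law D.carrier δ (a δ) (b δ) (badA ∪ sawReverse ⁻¹' badB) := measure_mono hsub
      _ ≤ SAW.law D.carrier δ (a δ) (b δ) badA + SAW.law D.carrier δ (a δ) (b δ) (sawReverse ⁻¹' badB) :=
          measure_union_le _ _
      _ ≤ ENNReal.ofReal (η / 3) + ENNReal.ofReal (η / 3) := add_le_add hAδ (by rw [hrev]; exact hBδ)
      _ = ENNReal.ofReal (η / 3 + η / 3) := (ENNReal.ofReal_add (by positivity) (by positivity)).symm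
  have := ENNReal.toReal_le_of_le_ofReal (by positivity) hle
  linarith

/-! ### The route item -/

/-- The route item `FaithfulOfNoReturn`, read through `AttachReversal.standardCurves` (definitional). -/
theorem faithfulOfNoReturn_iff :
    Theses.SAWReversalUpgrade.FaithfulOfNoReturn ↔
      ∀ (D : Literature.Probability.RandomPlanarGeometry.DobrushinDomain) (a b : ℝ → Literature.Probability.LatticeModels.Site 2), Literature.Probability.RandomPlanarGeometry.SAW.IsEndpointApprox D a b → ∀ (φ : Literature.Probability.RandomPlanarGeometry.ConformalEquiv UpperHalfPlane.upperHalfPlaneSet D.carrier), D.IsChordalUniformizing φ → ∀ (att : ((δ : ℝ) → Literature.Probability.RandomPlanarGeometry.SAW.DomainSAW (D).carrier δ (a δ) (b δ) → Literature.Probability.RandomPlanarGeometry.Curve ℂ)), (∀ᶠ δ in (nhdsWithin (0:ℝ) (Set.Ioi 0)), ∀ γ : Literature.Probability.RandomPlanarGeometry.SAW.DomainSAW (D).carrier δ (a δ) (b δ), (att δ γ ∈ Summit.CriticalPhenomena.SAWScalingLimit.Theorems.AttachReversal.standardCurves ((D).pt 0) ((D).pt 1) (φ).boundaryExtension (min δ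 (1/2)) (Summit.CriticalPhenomena.SAWScalingLimit.Theorems.AttachReversal.projLine (γ.walk.toCurve (Literature.Probability.LatticeModels.meshPoint δ))) (D).carrier)) → (∀ ε : ℝ, 0 < ε → ∀ η : ℝ, 0 < η → ∃ r : ℝ, 0 < r ∧ ∀ᶠ δ in (nhdsWithin (0:ℝ) (Set.Ioi 0)), Literature.Probability.RandomPlanarGeometry.SAW.law (D).carrier δ (a δ) (b δ) {γ | ∃ s t : unitInterval, s < t ∧ ε ≤ dist (γ.walk.toCurve (Literature.Probability.LatticeModels.meshPoint δ) s) ((D).pt 0) ∧ dist (γ.walk.toCurve (Literature.Probability.LatticeModels.meshPoint δ) t) ((D).pt 0) ≤ r} ≤ ENNReal.ofReal η) → (∀ ε : ℝ, 0 < ε → ∀ η : ℝ, 0 < η → ∃ r : ℝ, 0 < r ∧ ∀ᶠ δ in (nhdsWithin (0:ℝ) (Set.Ioi 0)), Literature.Probability.RandomPlanarGeometry.SAW.law (D.swap).carrier δ (b δ) (a δ) {γ | ∃ s t : unitInterval, s < t ∧ ε ≤ dist (γ.walk.toCurve (Literature.Probability.LatticeModels.meshPoint δ) s) ((D.swap).pt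 0) ∧ dist (γ.walk.toCurve (Literature.Probability.LatticeModels.meshPoint δ) t) ((D.swap).pt 0) ≤ r} ≤ ENNReal.ofReal η) → ∀ ε : ℝ, 0 < ε → Filter.Tendsto (fun δ : ℝ => (Literature.Probability.RandomPlanarGeometry.SAW.law D.carrier δ (a δ) (b δ) {γ | ε ≤ dist (Literature.Probability.RandomPlanarGeometry.CurveClass.mk (att δ γ)) γ.curve}).toReal) (nhdsWithin (0:ℝ) (Set.Ioi 0)) (nhds 0) :=
  Iff.rfl

end FaithfulAttach

/-- **Route `SAWReversalUpgrade`, support `FaithfulOfNoReturn` (stmt-CriticalPhenomena-18008), proved.** -/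
theorem FaithfulOfNoReturn_proof : Theses.SAWReversalUpgrade.FaithfulOfNoReturn :=
  FaithfulAttach.faithfulOfNoReturn_iff.2 fun D a b happ φ hφ att hatt hNa hNb ε hε =>
    FaithfulAttach.faithful_standard D a b happ φ hφ att hatt hNa hNb ε hε

end Summit.CriticalPhenomena.SAWScalingLimit.Theorems
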